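import Literature.AlgebraicGeometry.HodgeTheory.AlgebraicityLocusAssembly
import Literature.AlgebraicGeometry.Motives.HeightMorphism
import Literature.AlgebraicGeometry.Motives.ComplexPointsUncountable
import Literature.AlgebraicGeometry.Motives.CurveThroughTwoPointsProofs
import Literature.AlgebraicGeometry.Motives.PullbackOver
import Literature.AlgebraicGeometry.Motives.ChowZeroSupportedOnHyperplaneSection
import HarnessLib

/-!
# Spreading supports over a curve, I: a dominating good parameter variety and a multisection curve

Topic `Literature/AlgebraicGeometry/HodgeTheory` (family `hodge`). First proof file towards the named
fact `spread_supports_over_smoothCurve` (`SpreadSupportsOverCurve.lean`; Voisin, *Hodge Theory II*,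
§3.3.1 and proof of Thm. 10.19; Charles–Schnell, proof of Prop. 11.3.11), in the architecture of the
tree's structure theorem on algebraicity loci (`AlgebraicityLocusAssembly`): countably many PROPER
parameter `S`-schemes `h_i : H_i ⟶ S` with Zariski-closed families of supports `𝒵_i ⊆ 𝒳 × H_i`,
good sets `Good_i ⊆ H_i(ℂ)` (a good `y` has a slice of dimension `≤ n - p` pointwise off which the
class dies), and the GENERIC DICHOTOMY on irreducible closed subsets of the `H_i` (Verdier's input).
Here the base `S` is a smooth irreducible quasi-projective CURVE and EVERY complex point of `S` is
assumed good-witnessed (the class is algebraic on every fibre). Proved (sorry-free):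

* `exists_dominant_good` — some irreducible closed `Y ⊆ H_i`, good over a non-empty open part
  `O ∩ Y`, DOMINATES `S` (its generic point maps to the generic point of `S`): otherwise every
  complex point of `S` would lie under one of countably many closed points (Noetherian induction
  `exists_finite_isIrreducible_cover_of_dichotomy` gives finitely many good `Y` per `H_i`; a
  non-dominating `Y` maps to one closed point of the curve), contradicting the uncountability of
  `S(ℂ)` (`ComplexPoints.not_countable_of_smoothOfRelativeDimension`);
* `exists_irreducible_curve_subset` — inside such a `Y` there is an irreducible closed `D ⊆ Y`,
  the closure of the image of Mumford's curve through two good points over distinct points of `S`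
  (`Motives.mumford_smoothCurve_through_two_points_holds`), whose generic point lies in `O` and over
  the generic point of `S`, and all of whose other points are CLOSED points of `H_i` (heights do not
  increase under morphisms, `Motives.height_base_le_height_of_schemeOver`; a smooth curve has
  dimension `1`) — a multisection of `Y → S` through good points.

The spread set itself (push-forward of `𝒵_i|_D` along the proper `𝒳 ×_S H_i → 𝒳`, good slices
off the image of the bad points of `D`) is assembled in the companion file
`SpreadSupportsDominantFamilySpread`.

## References

* [VoisinHodgeII2003] C. Voisin, Hodge Theory and Complex Algebraic Geometry II (2003), §3.3.1;
  §10.2.1, proof of Thm. 10.19 (a dominating component of the relative Hilbert scheme and a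
  multisection).
* [CharlesSchnell2014Notes] F. Charles, C. Schnell, Notes on absolute Hodge classes (2014),
  Prop. 11.3.11 (proof).
* [MumfordAV1970] D. Mumford, Abelian Varieties (1970), §6, Lemma.
-/

noncomputable section

open CategoryTheory AlgebraicGeometry Limits Set Order MonoidalCategory CartesianMonoidalCategory
open _root_.Topology TopologicalSpace
open Literature.AlgebraicGeometry.Motives

universe u

namespace Literature.AlgebraicGeometry.HodgeTheory

section HodgeTheory

/-! ### Smooth irreducible curves: the generic point is not closed -/

section Curve

variable {S : Motives.SchemeOver ℂ} [IsIntegral S.left] [SmoothOfRelativeDimension 1 S.hom]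

/-- On a smooth integral curve the generic point is not the point of a complex point (the former has
height `1`, the latter is closed of height `0`). [folklore] -/
theorem pt_ne_top_of_smoothCurve (u : Motives.ComplexPoints S) : u.pt ≠ (⊤ : S.left) := by
  intro h
  have h1 := height_top_eq_one_of_smoothCurve (T := S)
  rw [← h] at h1
  have h0 : height u.pt = 0 := by
    refine Order.height_eq_zero.mpr fun y hy => ?_
    have hxy : u.pt ⤳ y := Scheme.le_iff_specializes.mp hy
    have hmem : y ∈ closure ({u.pt} : Set S.left) := specializes_iff_mem_closure.mp hxy
    rw [u.isClosed_pt.closure_eq, Set.mem_singleton_iff] at hmem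
    exact le_of_eq hmem.symm
  rw [h0] at h1
  exact zero_ne_one h1

/-- On a smooth integral curve, a point which specialises to the points of two DISTINCT complex
points is the generic point. [folklore] -/
theorem eq_top_of_specializes_pt_of_specializes_pt [LocallyOfFiniteType S.hom] {η : S.left}
    {u₁ u₂ : Motives.ComplexPoints S} (h₁ : η ⤳ u₁.pt) (h₂ : η ⤳ u₂.pt) (hne : u₁ ≠ u₂) :
    η = ⊤ := by
  by_contra hη
  have e₁ := eq_of_specializes_of_ne_top hη h₁
  have e₂ := eq_of_specializes_of_ne_top hη h₂
  exact hne (Motives.ComplexPoints.ext_of_pt_eq (e₁.trans e₂.symm))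

end Curve

/-! ### A dominating good parameter variety -/

section Dominant

variable {S : Motives.SchemeOver ℂ}

/-- **A dominating good parameter variety.** Let `S` be a smooth integral curve locally of finite
type over `ℂ`, and `h_i : H_i ⟶ S` (`i` in a countable index type) `ℂ`-morphisms from Noetherian
parameter schemes, with sets `Good_i ⊆ H_i(ℂ)` such that (`hall`) EVERY complex point of `S` lies
under a good complex point of some `H_i`, and (`hdich`) every irreducible closed `Y ⊆ H_i` has a
non-empty relatively open part over which either all complex points are good or none is. Then some
irreducible closed `Y ⊆ H_i` is good over a non-empty relatively open part `O ∩ Y` AND dominates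
`S`: `h_i` maps its generic point to the generic point of `S`. Proof: Noetherian induction
(`exists_finite_isIrreducible_cover_of_dichotomy`) covers the good points of each `H_i` by finitely
many such `Y`; if none dominated, each `h_i(Y)` would be one closed point of the curve
(`eq_of_specializes_of_ne_top`), and every complex point of `S` would lie under one of these
countably many points — impossible, `S(ℂ)` being uncountable
(`ComplexPoints.not_countable_of_smoothOfRelativeDimension`). This is the countability step of the
printed argument ("these countably many images cover the uncountable `U(ℂ)`, so one good component
dominates", Voisin II, proof of Thm. 10.19). [cite: VoisinHodgeII2003, §10.2.1 (proof of Thm. 10.19)]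
[cite: CharlesSchnell2014Notes, Prop. 11.3.11 (proof)] -/
theorem exists_dominant_good [IsIntegral S.left] [SmoothOfRelativeDimension 1 S.hom]
    [LocallyOfFiniteType S.hom] {ι : Type} [Countable ι] (H : ι → Motives.SchemeOver ℂ)
    (h : ∀ i, H i ⟶ S) [∀ i, NoetherianSpace (H i).left]
    (Good : ∀ i, Set (Motives.ComplexPoints (H i)))
    (hall : ∀ t : Motives.ComplexPoints S, ∃ i, ∃ y ∈ Good i, y ≫ h i = t)
    (hdich : ∀ i (Y : Set (H i).left), IsClosed Y → IsIrreducible Y →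
      ∃ O : Set (H i).left, IsOpen O ∧ (O ∩ Y).Nonempty ∧
        ((∀ y : Motives.ComplexPoints (H i), y.pt ∈ O ∩ Y → y ∈ Good i) ∨
          (∀ y : Motives.ComplexPoints (H i), y.pt ∈ O ∩ Y → y ∉ Good i))) :
    ∃ (i : ι) (Y : Set (H i).left) (_ : IsClosed Y) (hY : IsIrreducible Y) (O : Set (H i).left),
      IsOpen O ∧ (O ∩ Y).Nonempty ∧
      (∀ y : Motives.ComplexPoints (H i), y.pt ∈ O ∩ Y → y ∈ Good i) ∧
      (h i).left.base hY.genericPoint = ⊤ := by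
  -- finitely many good irreducible closed sets per parameter space
  have hfc : ∀ i, ∃ F : Set (Set (H i).left), F.Finite ∧
      (∀ Y ∈ F, IsClosed Y ∧ IsIrreducible Y ∧ ∃ O : Set (H i).left, IsOpen O ∧
        (O ∩ Y).Nonempty ∧ ∀ y : Motives.ComplexPoints (H i), y.pt ∈ O ∩ Y → y ∈ Good i) ∧
      ∀ y ∈ Good i, ∃ Y ∈ F, y.pt ∈ Y := fun i =>
    exists_finite_isIrreducible_cover_of_dichotomy (fun y : Motives.ComplexPoints (H i) => y.pt)
      (Good i) (hdich i)
  choose F hF hFgood hcov using hfc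
  by_contra hcon
  push Not at hcon
  -- every `Y ∈ F i` maps to one closed point `c i Y` of `S`
  have hpt : ∀ i, ∀ Y (hY : Y ∈ F i), ∀ y : Motives.ComplexPoints (H i), y.pt ∈ Y →
      (h i).left.base y.pt = (h i).left.base (hFgood i Y hY).2.1.genericPoint := by
    intro i Y hY y hy
    obtain ⟨hYc, hYirr, O, hOo, hOY, hOgood⟩ := hFgood i Y hY
    have hgen : IsGenericPoint (hFgood i Y hY).2.1.genericPoint Y := by
      have hg := (hFgood i Y hY).2.1.isGenericPoint_genericPoint_closure
      rwa [hYc.closure_eq] at hg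
    have hspec : (hFgood i Y hY).2.1.genericPoint ⤳ y.pt := hgen.specializes hy
    have hne : (h i).left.base (hFgood i Y hY).2.1.genericPoint ≠ ⊤ :=
      hcon i Y hYc (hFgood i Y hY).2.1 O hOo hOY hOgood
    exact eq_of_specializes_of_ne_top hne (hspec.map (h i).left.continuous)
  -- the countable set of these points carries every complex point of `S`
  set C : Set S.left := ⋃ i, ⋃ Y ∈ F i, {x | ∃ hY : Y ∈ F i,
    x = (h i).left.base (hFgood i Y hY).2.1.genericPoint} with hC
  have hCc : C.Countable := by
    refine Set.countable_iUnion fun i => (hF i).countable.biUnion fun Y hY => ?_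
    refine (Set.countable_singleton ((h i).left.base (hFgood i Y hY).2.1.genericPoint)).mono ?_
    rintro x ⟨hY', rfl⟩
    exact Set.mem_singleton _
  have hmaps : Set.MapsTo (fun t : Motives.ComplexPoints S => t.pt) Set.univ C := by
    intro t _
    obtain ⟨i, y, hy, hyt⟩ := hall t
    obtain ⟨Y, hY, hyY⟩ := hcov i y hy
    have htpt : t.pt = (h i).left.base y.pt := by
      rw [← hyt]
      rfl
    refine Set.mem_iUnion.2 ⟨i, Set.mem_iUnion₂.2 ⟨Y, hY, hY, ?_⟩⟩
    change t.pt = _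
    rw [htpt, hpt i Y hY y hyY]
  have hinj : Set.InjOn (fun t : Motives.ComplexPoints S => t.pt) Set.univ :=
    fun t _ t' _ htt' => Motives.ComplexPoints.ext_of_pt_eq htt'
  have hcount : (Set.univ : Set (Motives.ComplexPoints S)).Countable :=
    hmaps.countable_of_injOn hinj hCc
  haveI : Countable (Motives.ComplexPoints S) := Set.countable_univ_iff.1 hcount
  -- but `S(ℂ)` is uncountable
  obtain ⟨P, -⟩ := exists_complexPoint_pt_mem_inter (H := S) isOpen_univ isClosed_univ
    ⟨⊤, Set.mem_univ _, Set.mem_univ _⟩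
  exact Motives.ComplexPoints.not_countable_of_smoothOfRelativeDimension S 1 Nat.one_pos P
    inferInstance

end Dominant

/-! ### A multisection curve through good points -/

section Multisection

variable {S : Motives.SchemeOver ℂ}

/-- **An irreducible curve of good parameters dominating the base.** Let `S` be a smooth integral
curve locally of finite type over `ℂ`, `h : H ⟶ S` a parameter `ℂ`-scheme locally of finite type,
`Y ⊆ H` closed irreducible meeting an open `O`, with `h` mapping the generic point of `Y` to the
generic point of `S`. Then there are an irreducible closed `D ⊆ Y` with generic point `ξ ∈ O` over
the generic point of `S`, all of whose other points are CLOSED points of `H`. Construction: a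
complex point `y₁` over `O ∩ Y`, an affine chart `V ∋ y₁` of `H`, a second complex point `y₂` of
`O ∩ Y ∩ V` with `h(y₂) ≠ h(y₁)` (the generic point of `Y` lies in this open set), Mumford's smooth
irreducible curve `φ : C → V ⊆ H` inside `Y` through `y₁`, `y₂`
(`Motives.mumford_smoothCurve_through_two_points_holds`), `ξ := φ(η_C)`, `D := closure {ξ}`; `ξ`
specialises to `y₁, y₂`, so `h(ξ)` specialises to two distinct closed points of the curve `S` and
is its generic point; the points of `D` other than `ξ` have height `< height ξ ≤ height η_C = 1`
(`Motives.height_base_le_height_of_schemeOver`), i.e. height `0`, so they are closed.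
[cite: MumfordAV1970, §6, Lemma] [cite: VoisinHodgeII2003, §10.2.1 (proof of Thm. 10.19)] -/
theorem exists_irreducible_curve_subset [IsIntegral S.left] [SmoothOfRelativeDimension 1 S.hom]
    [LocallyOfFiniteType S.hom] {H : Motives.SchemeOver ℂ} [LocallyOfFiniteType H.hom] (h : H ⟶ S)
    {Y O : Set H.left} (hYc : IsClosed Y) (hY : IsIrreducible Y) (hOo : IsOpen O)
    (hOY : (O ∩ Y).Nonempty) (hdom : h.left.base hY.genericPoint = ⊤) :
    ∃ (D : Set H.left) (ξ : H.left), IsClosed D ∧ IsGenericPoint ξ D ∧ D ⊆ Y ∧ ξ ∈ O ∧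
      h.left.base ξ = ⊤ ∧ ∀ x ∈ D, x ≠ ξ → IsClosed ({x} : Set H.left) := by
  have hgen : IsGenericPoint hY.genericPoint Y := by
    have hg := hY.isGenericPoint_genericPoint_closure
    rwa [hYc.closure_eq] at hg
  -- a good complex point `y₁` and the complex point `u₁` of `S` under it
  obtain ⟨y₁, hy₁O, hy₁Y⟩ := exists_complexPoint_pt_mem_inter hOo hYc hOY
  set u₁ : Motives.ComplexPoints S := y₁ ≫ h with hu₁
  have hu₁pt : u₁.pt = h.left.base y₁.pt := rfl
  -- an affine open `V ∋ pt y₁` of `H`, as a `ℂ`-scheme `V'` with `ι' : V' ⟶ H`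
  obtain ⟨i, v, hv⟩ := H.left.affineCover.exists_eq y₁.pt
  set j : H.left.affineCover.X i ⟶ H.left := H.left.affineCover.f i with hj
  let V' : Motives.SchemeOver ℂ := Over.mk (j ≫ H.hom)
  let ι' : V' ⟶ H := Over.homMk j rfl
  haveI : IsAffine V'.left := inferInstanceAs (IsAffine (H.left.affineCover.X i))
  haveI : IsOpenImmersion ι'.left := inferInstanceAs (IsOpenImmersion j)
  haveI : LocallyOfFiniteType V'.hom := inferInstanceAs (LocallyOfFiniteType (j ≫ H.hom))
  haveI : LocallyOfFiniteType ι'.left := inferInstanceAs (LocallyOfFiniteType j)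
  -- a second complex point `y₂` of `O ∩ V ∩ Y` not over `u₁` (the generic point of `Y` is there)
  set O₂ : Set H.left := (O ∩ Set.range j.base) ∩ h.left.base ⁻¹' {u₁.pt}ᶜ with hO₂
  have hO₂o : IsOpen O₂ :=
    (hOo.inter j.isOpenEmbedding.isOpen_range).inter
      (u₁.isClosed_pt.isOpen_compl.preimage h.left.continuous)
  have hηO₂ : hY.genericPoint ∈ O₂ := by
    refine ⟨⟨(hgen.specializes hy₁Y).mem_open hOo hy₁O,
      (hgen.specializes hy₁Y).mem_open j.isOpenEmbedding.isOpen_range ⟨v, hv⟩⟩, ?_⟩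
    change h.left.base hY.genericPoint ∈ ({u₁.pt} : Set S.left)ᶜ
    rw [hdom, Set.mem_compl_iff, Set.mem_singleton_iff]
    exact fun he => pt_ne_top_of_smoothCurve u₁ he.symm
  obtain ⟨y₂, hy₂O₂, hy₂Y⟩ := exists_complexPoint_pt_mem_inter hO₂o hYc ⟨_, hηO₂, hgen.mem⟩
  -- lift `y₁`, `y₂` to `V'`
  obtain ⟨y₁', hy₁', -⟩ := exists_complexPoint_comp_eq_of_pt_mem ι' y₁ isClosed_univ
    (Set.mem_univ v) hv
  obtain ⟨v₂, hv₂⟩ := hy₂O₂.1.2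
  obtain ⟨y₂', hy₂', -⟩ := exists_complexPoint_comp_eq_of_pt_mem ι' y₂ isClosed_univ
    (Set.mem_univ v₂) hv₂
  have hy₁'map : AlgPoints.map ι' y₁' = y₁ := hy₁'
  have hy₂'map : AlgPoints.map ι' y₂' = y₂ := hy₂'
  have hpt₁ : j.base y₁'.pt = y₁.pt := by
    rw [← hy₁'map, AlgPoints.pt_map]
    rfl
  have hpt₂ : j.base y₂'.pt = y₂.pt := by
    rw [← hy₂'map, AlgPoints.pt_map]
    rfl
  have hu₁₂ : (y₁ ≫ h) ≠ (y₂ ≫ h) := by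
    intro he
    have h2 : h.left.base y₂.pt ∈ ({u₁.pt} : Set S.left)ᶜ := hy₂O₂.2
    apply h2
    rw [Set.mem_singleton_iff, hu₁pt]
    change (AlgPoints.map h y₂).pt = (AlgPoints.map h y₁).pt
    rw [AlgPoints.map_apply, AlgPoints.map_apply, he]
  have hne : y₁' ≠ y₂' := by
    intro he
    apply hu₁₂
    rw [← hy₁'map, ← hy₂'map, he]
  -- the closed irreducible `Y' = V ∩ Y` of `V'`
  set Y' : Set V'.left := j.base ⁻¹' Y with hY'def
  have hY'c : IsClosed Y' := hYc.preimage j.continuous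
  have hy₁'Y : y₁'.pt ∈ Y' := by
    change j.base y₁'.pt ∈ Y
    rw [hpt₁]
    exact hy₁Y
  have hy₂'Y : y₂'.pt ∈ Y' := by
    change j.base y₂'.pt ∈ Y
    rw [hpt₂]
    exact hy₂Y
  have hY' : IsIrreducible Y' := ⟨⟨y₁'.pt, hy₁'Y⟩, hY.isPreirreducible.preimage j.isOpenEmbedding⟩
  -- Mumford's lemma: a smooth irreducible affine curve in `Y'` through `y₁'`, `y₂'`
  obtain ⟨C, g, a', b', hCaff, hCirr, hCsm, hCdim, hgY, ha', hb'⟩ :=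
    mumford_smoothCurve_through_two_points_holds ‹_› ‹_› Y' hY'c hY' y₁' y₂' hy₁'Y hy₂'Y hne
  haveI := hCaff
  haveI := hCirr
  haveI := hCsm
  obtain ⟨hCint, hCrel⟩ := isIntegral_and_smoothOfRelativeDimension_one C hCdim
  haveI := hCint
  haveI := hCrel
  haveI : LocallyOfFiniteType C.hom := inferInstance
  -- the curve `φ : C ⟶ H`, the image `ξ` of its generic point and `D = closure {ξ}`
  set φ : C ⟶ H := g ≫ ι' with hφ
  set ξ : H.left := φ.left.base ⊤ with hξ
  have hφa : φ.left.base a'.pt = y₁.pt := by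
    change (AlgPoints.map φ a').pt = y₁.pt
    rw [hφ, AlgPoints.map_comp_apply, ha', hy₁'map]
  have hφb : φ.left.base b'.pt = y₂.pt := by
    change (AlgPoints.map φ b').pt = y₂.pt
    rw [hφ, AlgPoints.map_comp_apply, hb', hy₂'map]
  have hξ₁ : ξ ⤳ y₁.pt := by
    rw [← hφa]
    exact (genericPoint_specializes a'.pt).map φ.left.continuous
  have hξ₂ : ξ ⤳ y₂.pt := by
    rw [← hφb]
    exact (genericPoint_specializes b'.pt).map φ.left.continuous
  have hξY : ξ ∈ Y := by
    have h1 : g.left.base ⊤ ∈ Y' := hgY ⊤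
    exact h1
  refine ⟨closure {ξ}, ξ, isClosed_closure, isGenericPoint_closure, ?_, hξ₁.mem_open hOo hy₁O,
    ?_, fun x hx hxξ => ?_⟩
  · exact closure_minimal (Set.singleton_subset_iff.2 hξY) hYc
  · have h₁ : h.left.base ξ ⤳ (AlgPoints.map h y₁).pt := hξ₁.map h.left.continuous
    have h₂ : h.left.base ξ ⤳ (AlgPoints.map h y₂).pt := hξ₂.map h.left.continuous
    exact eq_top_of_specializes_pt_of_specializes_pt h₁ h₂ hu₁₂
  · -- `height x < height ξ ≤ height η_C = 1`
    have hξx : ξ ⤳ x := isGenericPoint_closure.specializes hx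
    have hle : x ≤ ξ := Scheme.le_iff_specializes.2 hξx
    have hlt : x < ξ := lt_of_le_not_ge hle fun hge =>
      hxξ ((Scheme.le_iff_specializes.1 hge).antisymm hξx).eq
    have hξ1 : height ξ ≤ 1 := by
      have h1 := height_base_le_height_of_schemeOver φ (⊤ : C.left)
      rwa [height_top_eq_one_of_smoothCurve (T := C)] at h1
    have hfin : height x < ⊤ :=
      lt_of_le_of_lt ((height_mono hle).trans hξ1) (by exact_mod_cast ENat.coe_lt_top 1)
    have h0 : height x = 0 := by
      have h2 : height x < 1 := lt_of_lt_of_le (height_strictMono hlt hfin) hξ1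
      exact Order.lt_one_iff.1 h2
    exact isClosed_singleton_of_height_eq_zero h0

end Multisection

end HodgeTheory

end Literature.AlgebraicGeometry.HodgeTheory

end
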